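import Summits.CriticalPhenomena.PercolationContinuityZ3.Theorems.PercNearOneGluingNoHeavyLowerTailCubicThreePointApexSplit
import Mathlib.Tactic.Ring
import Mathlib.Tactic.Linarith
import Mathlib.Tactic.Positivity
import HarnessLib

/-!
# `NoHeavyLowerTail` (stmt-CriticalPhenomena-4575) — the regime pair DECOUPLES into two regime-free rows, one per refined cell

Support file (prover prim-ineq-gen-2 gen 9, new-inequality factory; `--supports stmt-CriticalPhenomena-4575`).  Pure algebra over a
commutative ring / `ℝ`; no measure theory, no named facts, no sorries.  Cell convention of `…CubicThreePointApexSplit`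
(`CubicThreePointApex.{Gam, D1, D2}`, `CubicThreePointTerminal.{AG, Ha, Hb}`): apex `a`, cells `(q,u₁,u₂,u₃,t)`, refinements
`n = P(abc ∧ b ≁ c in ω ∖ a)` (root `{b,c}`, the S-representation cell) and `n′ = P(a|b|c ∧ V(C_a) separates b from c in G)`
(root `a`, the T-representation cell).

## What is recorded here (memo run/shared/lean/prim/prim-ineq-gen-2/REGIME-GEN9.md §1)
The surviving route to the sharp cubic row `Hmax3 = max(q,t)·AG − e₃ ≥ 0` is the REGIME PAIR
`{t ≥ q ⇒ D₂ ≥ 0} ∧ {q ≥ t ⇒ D₁ ≥ 0}` (`Ha_or_Hb_of_regime_pair`).  With the two one-cell sharpenings of Gladkov's form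
  `Γ₂ := AG − u₃·n`  (theorem, `…ThreePointGamma*`),   `Γ₁ := AG − u₃·n′`  (theorem, `CubicThreePointApex.gammaOne_nonneg`),
and the two repulsion slacks
  `S := u₁u₂ − q·n`   (BHK 2006 Thm 1.4, `≥ 0`),        `S′ := u₁u₂ − t·n′`  (dual BHK, `DualBHK.dualBHK`, `≥ 0`),
one has the four identities (`D2_eq`, `Hb_eq`, `D1_eq`, `Ha_eq`, by `ring`)
  `D₂ = t·Γ₂ − u₃·S`,   `Hb = q·Γ₂ − u₃·S`,   `D₁ = q·Γ₁ − u₃·S′`,   `Ha = t·Γ₁ − u₃·S′`.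
Hence (`R2_iff`, `R1_iff`, `regimePair_iff_R1_R2`; the rows are written out inline, no `def … : Prop`) the regime pair together with the two halves of SF3-Hmax is EQUIVALENT to the
conjunction of two REGIME-FREE rows, each involving only ONE refined cell:
  `(R2)  u₃·S  ≤ max(q,t)·Γ₂`   — cells `(q,u,t,n)` only  (S-representation),   `⟺ {t ≥ q ⇒ D₂ ≥ 0} ∧ {q ≥ t ⇒ Hb ≥ 0}`;
  `(R1)  u₃·S′ ≤ max(q,t)·Γ₁`   — cells `(q,u,t,n′)` only (T-representation),   `⟺ {q ≥ t ⇒ D₁ ≥ 0} ∧ {t ≥ q ⇒ Ha ≥ 0}`;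
and `(R1) ∧ (R2) ⟹ Hmax3 ≥ 0` (`hmax3_of_R1_R2`).  Each row is an EQUALITY on one identity family in one regime (`R2_star`: `t·Γ₂ = u₃·S`
on every star; `R1_triangle`: `q·Γ₁ = u₃·S′` on every triangle), lies strictly between the theorem `Γᵢ ≥ 0` (its `max → ∞` limit) and
the false unconditional forms `Ha ≥ 0` / `Hb ≥ 0`, and reads, with the Harris covariances `H := (t−n)q − u₃(u₁+u₂+n) = Cov(1{a~b ∨ a~c},
1{b~c in ω∖a}) ≥ 0` and `H′ := (q−n′)t − u₃(u₁+u₂+n′) = −Cov(1{b,c ∉ C_a ∧ ¬Sep}, 1{b~c}) ≥ 0` (`Gam2_eq_H_sub_S`, `Gam1_eq_H'_sub_S'`):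
"the (dual-)BHK repulsion slack is at most the fraction `max(q,t)/(max(q,t)+u₃)` of the corresponding Harris covariance"
(`R2_iff_frac`, `R1_iff_frac`).  STATUS (2026-08-20): (R1), (R2) CONJECTURED — 0 violations in 10.8 M / 16.9 M exact-rechecked skew-probe
instances (heavy-star / light-core, light pendants, random two- and three-level weights, sparse supports n ≤ 9) and in a first-order
probe at every tight locus (REGIME-GEN9.md §2), on top of ttrl2's exhaustive n ≤ 8 census and climbs n ≤ 12 of the regime pair.
[cite: Gladkov2024StrongFKG, Cor. 4.2 (the quadratic form AG)]; [cite: VandenbergHaggstromKahn2005, Thm 1.4 (u₁u₂ ≥ qn)]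
-/

namespace Summit.CriticalPhenomena.PercolationContinuityZ3.Theorems

namespace CubicThreePointApex

open CubicThreePointTerminal CubicThreePointSharp

variable {R : Type*} [CommRing R]

/-! ### The two one-cell rows and the two repulsion slacks (any commutative ring) -/

/-- `Γ₂ = AG − u₃·n` (S-representation sharpening of Gladkov's form; a theorem on every weighted graph). [folklore] -/
def Gam2 (q u₁ u₂ u₃ t n : R) : R := AG q u₁ u₂ u₃ t - u₃ * n

/-- `Γ₁ = AG − u₃·n′` (T-representation sharpening; a theorem on every weighted graph, `gammaOne_nonneg`). [folklore] -/
def Gam1 (q u₁ u₂ u₃ t n' : R) : R := AG q u₁ u₂ u₃ t - u₃ * n'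

/-- BHK repulsion slack `S = u₁u₂ − q·n` (`≥ 0` by van den Berg–Häggström–Kahn 2006, Thm 1.4). [folklore] -/
def SBHK (q u₁ u₂ n : R) : R := u₁ * u₂ - q * n

/-- Dual-BHK repulsion slack `S′ = u₁u₂ − t·n′` (`≥ 0`, `DualBHK.dualBHK`). [folklore] -/
def SdBHK (u₁ u₂ t n' : R) : R := u₁ * u₂ - t * n'

/-- Harris covariance of the S-representation, `H = (t−n)·q − u₃·(u₁+u₂+n) = Cov(1{a~b ∨ a~c}, 1{b~c in ω∖a})`. [folklore] -/
def HarS (q u₁ u₂ u₃ t n : R) : R := (t - n) * q - u₃ * (u₁ + u₂ + n)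

/-- Harris covariance of the T-representation, `H′ = (q−n′)·t − u₃·(u₁+u₂+n′) = −Cov(1{b,c ∉ C_a ∧ ¬Sep}, 1{b~c})`. [folklore] -/
def HarT (q u₁ u₂ u₃ t n' : R) : R := (q - n') * t - u₃ * (u₁ + u₂ + n')

/-- `Γ = Γ₁ + Γ₂ − AG`. [folklore] -/
theorem Gam_eq_Gam1_add_Gam2 (q u₁ u₂ u₃ t n n' : R) :
    Gam q u₁ u₂ u₃ t n n' = Gam1 q u₁ u₂ u₃ t n' + Gam2 q u₁ u₂ u₃ t n - AG q u₁ u₂ u₃ t := by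
  simp only [Gam, Gam1, Gam2]; ring

/-- `D₂ = t·Γ₂ − u₃·S`. [folklore] -/
theorem D2_eq (q u₁ u₂ u₃ t n : R) :
    D2 q u₁ u₂ u₃ t n = t * Gam2 q u₁ u₂ u₃ t n - u₃ * SBHK q u₁ u₂ n := by
  simp only [D2, Gam2, SBHK, Ha, AG]; ring

/-- `Hb = q·Γ₂ − u₃·S` — the sparse half of SF3-Hmax is the `q`-weighted form of the SAME one-cell row. [folklore] -/
theorem Hb_eq (q u₁ u₂ u₃ t n : R) :
    Hb q u₁ u₂ u₃ t = q * Gam2 q u₁ u₂ u₃ t n - u₃ * SBHK q u₁ u₂ n := by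
  simp only [Gam2, SBHK, Hb, AG]; ring

/-- `D₁ = q·Γ₁ − u₃·S′`. [folklore] -/
theorem D1_eq (q u₁ u₂ u₃ t n' : R) :
    D1 q u₁ u₂ u₃ t n' = q * Gam1 q u₁ u₂ u₃ t n' - u₃ * SdBHK u₁ u₂ t n' := by
  simp only [D1, Gam1, SdBHK, Hb, AG]; ring

/-- `Ha = t·Γ₁ − u₃·S′` — the dense half of SF3-Hmax is the `t`-weighted form of the T-representation row. [folklore] -/
theorem Ha_eq (q u₁ u₂ u₃ t n' : R) :
    Ha q u₁ u₂ u₃ t = t * Gam1 q u₁ u₂ u₃ t n' - u₃ * SdBHK u₁ u₂ t n' := by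
  simp only [Gam1, SdBHK, Ha, AG]; ring

/-- `Γ₂ = H − S`: the S-representation row is "Harris covariance minus BHK slack". [folklore] -/
theorem Gam2_eq_H_sub_S {q u₁ u₂ u₃ t n : R} (hσ : q + u₁ + u₂ + u₃ + t = 1) :
    Gam2 q u₁ u₂ u₃ t n = HarS q u₁ u₂ u₃ t n - SBHK q u₁ u₂ n := by
  have ht : t = 1 - q - u₁ - u₂ - u₃ := by rw [← hσ]; ring
  simp only [Gam2, HarS, SBHK, AG, ht]; ring

/-- `Γ₁ = H′ − S′`. [folklore] -/
theorem Gam1_eq_H'_sub_S' {q u₁ u₂ u₃ t n' : R} (hσ : q + u₁ + u₂ + u₃ + t = 1) :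
    Gam1 q u₁ u₂ u₃ t n' = HarT q u₁ u₂ u₃ t n' - SdBHK u₁ u₂ t n' := by
  have hq : q = 1 - t - u₁ - u₂ - u₃ := by rw [← hσ]; ring
  simp only [Gam1, HarT, SdBHK, AG, hq]; ring

/-! ### Tightness: (R2) is an equality on stars, (R1) on triangles -/

/-- STAR law (arms `α, β, γ` at `a, b, c`; apex `a`; `n = 0`): `t·Γ₂ = u₃·S` — the row (R2) is an equality on every star. [folklore] -/
theorem R2_star (α β γ : R) :
    (α * β * γ) * Gam2 (1 - (α * β + α * γ + β * γ) + 2 * (α * β * γ)) (α * β * (1 - γ)) (α * γ * (1 - β))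
        (β * γ * (1 - α)) (α * β * γ) 0
      = (β * γ * (1 - α)) * SBHK (1 - (α * β + α * γ + β * γ) + 2 * (α * β * γ)) (α * β * (1 - γ)) (α * γ * (1 - β)) 0 := by
  simp only [Gam2, SBHK, AG]; ring

/-- TRIANGLE law (`p_bc = x, p_ac = y, p_ab = z`; apex `a`; `n′ = 0`): `q·Γ₁ = u₃·S′` — (R1) is an equality on every triangle. [folklore] -/
theorem R1_triangle (x y z : R) :
    ((1 - x) * (1 - y) * (1 - z)) * Gam1 ((1 - x) * (1 - y) * (1 - z)) (z * (1 - x) * (1 - y)) (y * (1 - x) * (1 - z))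
        (x * (1 - y) * (1 - z)) (x * y + x * z + y * z - 2 * (x * y * z)) 0
      = (x * (1 - y) * (1 - z)) * SdBHK (z * (1 - x) * (1 - y)) (y * (1 - x) * (1 - z))
        (x * y + x * z + y * z - 2 * (x * y * z)) 0 := by
  simp only [Gam1, SdBHK, AG]; ring

/-! ### The decoupling (real cells).  Row (R2) := `u₃·S ≤ max(q,t)·Γ₂`; row (R1) := `u₃·S′ ≤ max(q,t)·Γ₁` (written out inline). -/

/-- (R2) `u₃·S ≤ max(q,t)·Γ₂  ⟺  {t ≥ q ⇒ D₂ ≥ 0} ∧ {q ≥ t ⇒ Hb ≥ 0}`. [folklore] -/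
theorem R2_iff (q u₁ u₂ u₃ t n : ℝ) :
    u₃ * SBHK q u₁ u₂ n ≤ max q t * Gam2 q u₁ u₂ u₃ t n
      ↔ (q ≤ t → 0 ≤ D2 q u₁ u₂ u₃ t n) ∧ (t ≤ q → 0 ≤ Hb q u₁ u₂ u₃ t) := by
  rw [D2_eq, Hb_eq q u₁ u₂ u₃ t n]
  constructor
  · intro h
    refine ⟨fun hqt => ?_, fun htq => ?_⟩
    · rw [max_eq_right hqt] at h; linarith
    · rw [max_eq_left htq] at h; linarith
  · rintro ⟨h1, h2⟩
    rcases le_total q t with hqt | htq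
    · rw [max_eq_right hqt]; linarith [h1 hqt]
    · rw [max_eq_left htq]; linarith [h2 htq]

/-- (R1) `u₃·S′ ≤ max(q,t)·Γ₁  ⟺  {q ≥ t ⇒ D₁ ≥ 0} ∧ {t ≥ q ⇒ Ha ≥ 0}`. [folklore] -/
theorem R1_iff (q u₁ u₂ u₃ t n' : ℝ) :
    u₃ * SdBHK u₁ u₂ t n' ≤ max q t * Gam1 q u₁ u₂ u₃ t n'
      ↔ (t ≤ q → 0 ≤ D1 q u₁ u₂ u₃ t n') ∧ (q ≤ t → 0 ≤ Ha q u₁ u₂ u₃ t) := by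
  rw [D1_eq, Ha_eq q u₁ u₂ u₃ t n']
  constructor
  · intro h
    refine ⟨fun htq => ?_, fun hqt => ?_⟩
    · rw [max_eq_left htq] at h; linarith
    · rw [max_eq_right hqt] at h; linarith
  · rintro ⟨h1, h2⟩
    rcases le_total q t with hqt | htq
    · rw [max_eq_right hqt]; linarith [h2 hqt]
    · rw [max_eq_left htq]; linarith [h1 htq]

/-- **Decoupling.**  For nonnegative `u₃, n, n′` the regime pair is EQUIVALENT to `(R1) ∧ (R2)`: the two SF3 halves hidden in (R1), (R2)
(`Ha ≥ 0` dense, `Hb ≥ 0` sparse) are implied by the regime pair (`Ha = D₂ + (t−q)u₃n`, `Hb = D₁ + (q−t)u₃n′`). [folklore] -/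
theorem regimePair_iff_R1_R2 {q u₁ u₂ u₃ t n n' : ℝ} (hu₃ : 0 ≤ u₃) (hn : 0 ≤ n) (hn' : 0 ≤ n') :
    ((q ≤ t → 0 ≤ D2 q u₁ u₂ u₃ t n) ∧ (t ≤ q → 0 ≤ D1 q u₁ u₂ u₃ t n'))
      ↔ (u₃ * SdBHK u₁ u₂ t n' ≤ max q t * Gam1 q u₁ u₂ u₃ t n'
          ∧ u₃ * SBHK q u₁ u₂ n ≤ max q t * Gam2 q u₁ u₂ u₃ t n) := by
  rw [R1_iff, R2_iff]
  have eD2 : D2 q u₁ u₂ u₃ t n = Ha q u₁ u₂ u₃ t - (t - q) * u₃ * n := rfl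
  have eD1 : D1 q u₁ u₂ u₃ t n' = Hb q u₁ u₂ u₃ t - (q - t) * u₃ * n' := rfl
  constructor
  · rintro ⟨hD2, hD1⟩
    refine ⟨⟨hD1, fun hqt => ?_⟩, ⟨hD2, fun htq => ?_⟩⟩
    · have h := hD2 hqt
      nlinarith [mul_nonneg (mul_nonneg (sub_nonneg.mpr hqt) hu₃) hn]
    · have h := hD1 htq
      nlinarith [mul_nonneg (mul_nonneg (sub_nonneg.mpr htq) hu₃) hn']
  · rintro ⟨⟨hD1, _⟩, ⟨hD2, _⟩⟩
    exact ⟨hD2, hD1⟩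

/-- `(R1) ∧ (R2) ⟹ Hmax3 ≥ 0` (for `AG ≥ 0`): in the dense regime (R1) gives `Ha ≥ 0`, in the sparse regime (R2) gives `Hb ≥ 0`. [folklore] -/
theorem hmax3_of_R1_R2 {q u₁ u₂ u₃ t n n' : ℝ} (hag : 0 ≤ AG q u₁ u₂ u₃ t)
    (h1 : u₃ * SdBHK u₁ u₂ t n' ≤ max q t * Gam1 q u₁ u₂ u₃ t n')
    (h2 : u₃ * SBHK q u₁ u₂ n ≤ max q t * Gam2 q u₁ u₂ u₃ t n) :
    0 ≤ max q t * AG q u₁ u₂ u₃ t - u₁ * u₂ * u₃ := by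
  rw [← max_Ha_Hb hag]
  rcases le_total q t with hqt | htq
  · exact le_trans (((R1_iff q u₁ u₂ u₃ t n').mp h1).2 hqt) (le_max_left _ _)
  · exact le_trans (((R2_iff q u₁ u₂ u₃ t n).mp h2).2 htq) (le_max_right _ _)

/-- (R2) in Harris form on the simplex: `u₃·S ≤ max(q,t)·Γ₂ ⟺ S·(max(q,t) + u₃) ≤ max(q,t)·H`
("the BHK slack is at most the fraction `max/(max+u₃)` of the Harris covariance `H`"). [folklore] -/
theorem R2_iff_frac {q u₁ u₂ u₃ t n : ℝ} (hσ : q + u₁ + u₂ + u₃ + t = 1) :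
    u₃ * SBHK q u₁ u₂ n ≤ max q t * Gam2 q u₁ u₂ u₃ t n
      ↔ SBHK q u₁ u₂ n * (max q t + u₃) ≤ max q t * HarS q u₁ u₂ u₃ t n := by
  rw [Gam2_eq_H_sub_S hσ]
  constructor <;> intro h <;> nlinarith [h]

/-- (R1) in Harris form on the simplex: `u₃·S′ ≤ max(q,t)·Γ₁ ⟺ S′·(max(q,t) + u₃) ≤ max(q,t)·H′`. [folklore] -/
theorem R1_iff_frac {q u₁ u₂ u₃ t n' : ℝ} (hσ : q + u₁ + u₂ + u₃ + t = 1) :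
    u₃ * SdBHK u₁ u₂ t n' ≤ max q t * Gam1 q u₁ u₂ u₃ t n'
      ↔ SdBHK u₁ u₂ t n' * (max q t + u₃) ≤ max q t * HarT q u₁ u₂ u₃ t n' := by
  rw [Gam1_eq_H'_sub_S' hσ]
  constructor <;> intro h <;> nlinarith [h]

/-- Sanity: (R2) together with BHK (`S ≥ 0`) and `u₃ ≥ 0` gives back the theorem `Γ₂ ≥ 0` whenever `max(q,t) > 0`. [folklore] -/
theorem Gam2_nonneg_of_R2 {q u₁ u₂ u₃ t n : ℝ} (hm : 0 < max q t) (hu₃ : 0 ≤ u₃) (hS : 0 ≤ SBHK q u₁ u₂ n)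
    (h : u₃ * SBHK q u₁ u₂ n ≤ max q t * Gam2 q u₁ u₂ u₃ t n) : 0 ≤ Gam2 q u₁ u₂ u₃ t n := by
  have hmG : 0 ≤ max q t * Gam2 q u₁ u₂ u₃ t n := le_trans (mul_nonneg hu₃ hS) h
  by_contra hG
  have : max q t * Gam2 q u₁ u₂ u₃ t n < 0 := mul_neg_of_pos_of_neg hm (lt_of_not_ge hG)
  linarith

end CubicThreePointApex

end Summit.CriticalPhenomena.PercolationContinuityZ3.Theorems
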